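import Summits.BirchSwinnertonDyer.BirchSwinnertonDyer.Theses.UniversalToricDescent
import Summits.BirchSwinnertonDyer.BirchSwinnertonDyer.Theorems.UniversalToricDescentHessianTwinSupplyAtThree
import HarnessLib

/-!
# Route UniversalToricDescent — DIRECT closer of the support item 23595 `GoodSSApZeroTwinSupplyAtThree`
# (the `a₃ = 0` twin supply on the attacked cell), by utd-p2's unconditional Hessian-twice theorem

Prover bsd-wall-utd-p1 g8 (`--workitem stmt-BirchSwinnertonDyer-23595`; a direct proof of the SPLIT parent,
as invited by the route file). utd-p2 g7 proved the supply for EVERY elliptic curve over `ℚ`, with no `3`-adic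
type hypothesis: `UniversalToricDescentHessianTwin.hasGoodSSApZeroTwinAtThree_of_hasGoodSSTwinAtThree`
(p587145 — a globally minimal good-supersingular twin has `3 ∣ b₂`, its rescaled Hessian is wild of type
`(4, ≥ 8)`, whose Hessian is a `3`-congruent good-supersingular twin with `a₃ = 0`; Fisher 2012 Thm. 13.2
twice). This file restates it at the route decl (whose extra hypotheses `ClassO6`, `r_an = 1`, `ρ̄₃` onto are
not used). THEOREM ONLY; BSD is not advanced by this file.
References: [Fisher2012Hessian] Thm. 13.2; [RubinSilverberg1995] §1.
-/

set_option autoImplicit false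
-- `…BirchSwinnertonDyer.BirchSwinnertonDyer.Theorems…` is the problem's mandated namespace (D-0017).
set_option linter.dupNamespace false

namespace Summit.BirchSwinnertonDyer.BirchSwinnertonDyer.Theorems

/-- **Item 23595 holds**: every curve of the cell with a `3`-congruent good-supersingular twin has one with
`a₃ = 0` — indeed every elliptic curve over `ℚ` does (utd-p2 g7, p587145). [cite: Fisher2012Hessian, Thm. 13.2] -/
theorem goodSSApZeroTwinSupplyAtThree_proof :
    Summit.BirchSwinnertonDyer.BirchSwinnertonDyer.Theses.UniversalToricDescent.GoodSSApZeroTwinSupplyAtThree :=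
  fun W _ _ _ _ _ htwin ↦
    UniversalToricDescentHessianTwin.hasGoodSSApZeroTwinAtThree_of_hasGoodSSTwinAtThree W htwin

end Summit.BirchSwinnertonDyer.BirchSwinnertonDyer.Theorems
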